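import Literature.Probability.Percolation.PortChain
import Literature.Probability.Percolation.PortCount
import HarnessLib

/-!
# Contracting the ports: the crossing event as a function of the data and the port-level bits

Topic `Probability/Percolation`.  Support file (definitions and proofs, no named fact) for step (C)
of the proof of Schramm–Smirnov's Prop. 4.1 (Ann. Probab. 39 (2011), §4: the vertices of the
graphs `G`, `G*` are the open BAYS).  The side-level structure theorem
`TileData.mem_z2QuadConfig_iff_sideChain` (`PortChain.lean`) is coarsened to the PORTS (maximal
open stretches of the traced loop): by the port theorem (`hubConn_of_open_stretch'`) any two hub
contacts of one open stretch are joined by examined open edges, hence revealed-connected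
(`gst_of_samePort`), so docking bits may be replaced by port-level bits `PortBit` between
DIFFERENT ports (`mem_z2QuadConfig_iff_portChain`).  With the owner count (`exists_owners`) the
number of distinct port-level bits is bounded on the good event; their identification with the
crossing events of the link quads (`Ports.mem_z2QuadConfig_linkQuad_iff_docking`) is used in the
sequel for the coarse-grained surrogate.

## References

* O. Schramm, S. Smirnov, *On the scaling limits of planar percolation*, Ann. Probab. 39 (2011)
  1768–1814, arXiv:1101.5820, §4, proof of Prop. 4.1. [SchrammSmirnov2011]
-/

noncomputable section

open Set Relation
open Literature.Probability.LatticeModels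
open scoped Classical

namespace Literature.Probability.Percolation

namespace CellComplex

namespace TileData

open QuadCrossing

variable {𝒯 : TileData} {d₀ : Site 2 × Fin 4} {D : Set ℂ} {δ : ℝ} {Q : Quad D} {η : BondConfig (Site 2)}

/-! ### Hub-connected vertices are revealed-connected -/

/-- **Examined open paths are revealed connections**: if examined open edges are open and drawn
inside the carrier, hub-connected vertices have revealed-connected mesh points.
[cite: SchrammSmirnov2011, §4, proof of Prop. 4.1 (the graph G: "connected by an open crossing in ω̃|M")] -/
theorem revPt_of_hubConn (hhubη : ∀ e ∈ 𝒯.hubE, e ∈ η)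
    (hhubQ : ∀ (y : Site 2) (m : Fin 4), dartEdge y m ∈ 𝒯.hubE →
      segment ℝ (meshPoint δ y) (meshPoint δ (y + cornerUnit m)) ⊆ Q.carrier)
    {v w : Site 2} (h : 𝒯.HubConn v w)
    (hv : meshPoint δ v ∈ openEdgeUnion δ (η \ ↑𝒯.acc) ∧ meshPoint δ v ∈ Q.carrier) :
    𝒯.RevPt Q δ η (meshPoint δ v) (meshPoint δ w) := by
  induction h with
  | refl => exact RevPt.of_mem hv.1 hv.2
  | @tail a b _ hab ih =>
    -- the examined open edge `{a, b}` is drawn inside the carrier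
    have hE : s(a, b) ∈ (zdGraph 2).edgeSet := 𝒯.hub_edge _ hab
    obtain ⟨m, hm⟩ := exists_eq_dartEdge_of_mem hE (Sym2.mem_mk_left a b)
    have hb : b = a + cornerUnit m := by
      have : b ∈ dartEdge a m := hm ▸ Sym2.mem_mk_right a b
      rcases mem_dartEdge_iff.1 this with h | h
      · -- `b = a`: a loop is not a lattice edge
        exact absurd h.symm ((SimpleGraph.mem_edgeSet (G := zdGraph 2)).1 hE).ne
      · exact h
    subst hb
    rw [hm] at hab
    set S : Set ℂ := segment ℝ (meshPoint δ a) (meshPoint δ (a + cornerUnit m)) with hS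
    have hSsub : S ⊆ openEdgeUnion δ (η \ ↑𝒯.acc) ∩ Q.carrier := by
      refine subset_inter (fun z hz => ?_) (hhubQ a m hab)
      rw [mem_openEdgeUnion_iff]
      exact ⟨a, a + cornerUnit m, adj_iff_exists_cornerUnit.2 ⟨m, rfl⟩, ⟨hhubη _ hab, fun h => 𝒯.acc_not_hub _ h hab⟩, hz⟩
    exact ih.trans ⟨S, hSsub, (convex_segment _ _).isPreconnected, left_mem_segment _ _ _, right_mem_segment _ _ _⟩

/-- **Attached vertices of hub contacts are window vertices** (a far hub vertex has only wet
faces, `Terminal.far_wet`, while the in-cell of the contact is a dry face or an accessible bond at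
the vertex). [folklore] -/
theorem att_mem_Wv (hT : 𝒯.Terminal) (h₀ : IsBd 𝒯.U d₀) {i : ℕ} (hi : 𝒯.hubContact d₀ i) {v : Site 2}
    (hv : v ∈ 𝒯.att (𝒯.outCell d₀ i)) : v ∈ 𝒯.Wv := by
  by_contra hvW
  have hvO : v ∈ 𝒯.O := hv.1
  have hin : faceAt (vert 𝒯.U d₀ i) (dirAt 𝒯.U d₀ i) ∈ 𝒯.U := (isBd_bdOrbit h₀ i).1
  -- every face at `v` is wet
  have hwet : ∀ f, TouchesFace v f → f ∈ 𝒯.Dset := fun f hf => hT.far_wet v f hvO hvW hf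
  -- corner bookkeeping at the tail of the dart: in-cell `faceAt w k`, out-cell `faceAt w (k+3)`
  set w := vert 𝒯.U d₀ i with hw
  set k := dirAt 𝒯.U d₀ i with hk
  have hout : 𝒯.outCell d₀ i = faceAt w (k + 3) := rfl
  obtain ⟨y, j, hyj⟩ := exists_corner_eq w
  obtain ⟨t, ht⟩ := fin4_exists_add j k
  rw [hyj, ht] at hin hout
  rcases (show t = 0 ∨ t = 1 ∨ t = 2 ∨ t = 3 by fin_cases t <;> simp) with rfl | rfl | rfl | rfl
  · -- in-cell `σ y` accessible, out-cell `β y (j+3)`: attached vertices are `y`, `y + e_{j+3}`, both window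
    rw [add_zero, faceAt_corner_self] at hin
    rw [add_zero, faceAt_corner_add_three] at hout
    obtain ⟨hyO, a, ha, hya⟩ := (σc_mem_U_iff 𝒯).1 hin
    rw [hout] at hv
    rcases hv.2 with h | ⟨m, h⟩
    · exact absurd h (σc_ne_βc v y (j + 3)).symm
    · -- `v` is an endpoint of the hub edge `dartEdge y (j+3)`; `y ∉ O`, so `v = y + e_{j+3}`… but hub edges join hub vertices
      have he : dartEdge y (j + 3) = dartEdge v m :=
        bcell_injOn (dartEdge_mem_edgeSet _ _) (dartEdge_mem_edgeSet _ _) (by rw [bcell_dartEdge, bcell_dartEdge, h])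
      -- the out-cell is a hub cell: its edge is examined open, so `y ∈ O`, contradiction
      rcases hi with ⟨x, -, hx⟩ | ⟨y', m', hhub, hy'⟩
      · rw [hout] at hx; exact absurd hx.symm (σc_ne_βc x y (j + 3))
      · rw [hout] at hy'
        have he' : dartEdge y (j + 3) = dartEdge y' m' :=
          bcell_injOn (dartEdge_mem_edgeSet _ _) (dartEdge_mem_edgeSet _ _) (by rw [bcell_dartEdge, bcell_dartEdge, hy'])
        exact hyO (𝒯.hub_O _ (he' ▸ hhub) y (mem_dartEdge_iff.2 (Or.inl rfl)))
  · -- in-cell `β y (j+2)` accessible at `y`, out-cell `σ y`: `v = y ∈ Wv`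
    rw [faceAt_corner_add_one] at hin
    rw [fin4_add_one_add_three, faceAt_corner_self] at hout
    rw [hout] at hv
    obtain ⟨rfl, -⟩ := mem_att_σc_iff.1 hv
    exact hvW (𝒯.acc_window _ ((βc_mem_U_iff 𝒯).1 hin) v (mem_dartEdge_iff.2 (Or.inl rfl)))
  · -- in-cell the dry face `φ (faceAt y (j+2))`, out-cell `β y (j+2)`: `v` is an endpoint of that edge, a corner of the face
    rw [faceAt_corner_add_two] at hin
    rw [fin4_add_two_add_three, faceAt_corner_add_one] at hout
    obtain ⟨hfD, -⟩ := (φc_mem_U_iff 𝒯).1 hin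
    rw [hout] at hv
    rcases hv.2 with h | ⟨m, h⟩
    · exact absurd h (σc_ne_βc v y (j + 2)).symm
    · have he : dartEdge y (j + 2) = dartEdge v m :=
        bcell_injOn (dartEdge_mem_edgeSet _ _) (dartEdge_mem_edgeSet _ _) (by rw [bcell_dartEdge, bcell_dartEdge, h])
      have hvmem : v ∈ dartEdge y (j + 2) := he ▸ mem_dartEdge_iff.2 (Or.inl rfl)
      exact hfD (hwet _ (touchesFace_of_isFaceOf (dartEdge_mem_edgeSet _ _)
        (isFaceOf_dartEdge_iff.2 (Or.inl rfl)) hvmem))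
  · -- out-cell a face cell: not a hub cell
    rw [fin4_add_three_add_three, faceAt_corner_add_two] at hout
    rw [TileData.hubContact, hout] at hi
    exact 𝒯.not_isHubCell_φc _ hi

/-- The mesh point of a window hub vertex lies in the carrier when examined open edges are drawn
inside it. [folklore] -/
theorem meshPoint_mem_carrier_of_hub
    (hhubQ : ∀ (y : Site 2) (m : Fin 4), dartEdge y m ∈ 𝒯.hubE →
      segment ℝ (meshPoint δ y) (meshPoint δ (y + cornerUnit m)) ⊆ Q.carrier)
    {x : Site 2} (hxO : x ∈ 𝒯.O) (hxW : x ∈ 𝒯.Wv) : meshPoint δ x ∈ Q.carrier := by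
  obtain ⟨u, huW, hpath⟩ := 𝒯.esc_O x hxO
  obtain ⟨y, hxy⟩ : ∃ y, s(x, y) ∈ 𝒯.hubE := by
    induction hpath using ReflTransGen.head_induction_on with
    | refl => exact absurd hxW huW
    | head h _ _ => exact ⟨_, h⟩
  have hE : s(x, y) ∈ (zdGraph 2).edgeSet := 𝒯.hub_edge _ hxy
  obtain ⟨m, hm⟩ := exists_eq_dartEdge_of_mem hE (Sym2.mem_mk_left x y)
  exact hhubQ x m (hm ▸ hxy) (left_mem_segment _ _ _)

/-! ### Hub contacts of one open stretch are revealed-connected -/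

section Stretch

variable (h₀ : IsBd 𝒯.U d₀) (hT : 𝒯.Terminal)
  (hfar : ∀ c c' u₁ u₂ : Site 2, c ∈ 𝒯.O → c' ∈ 𝒯.O → (∃ f, TouchesFace c f ∧ TouchesFace c' f) →
    u₁ ∉ 𝒯.Wv → u₂ ∉ 𝒯.Wv → ReflTransGen (fun a b => s(a, b) ∈ 𝒯.hubE) c u₁ →
    ReflTransGen (fun a b => s(a, b) ∈ 𝒯.hubE) c' u₂ → ReflTransGen (FarAdj 𝒯) u₂ u₁)
  (hhubη : ∀ e ∈ 𝒯.hubE, e ∈ η)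
  (hhubQ : ∀ (y : Site 2) (m : Fin 4), dartEdge y m ∈ 𝒯.hubE →
    segment ℝ (meshPoint δ y) (meshPoint δ (y + cornerUnit m)) ⊆ Q.carrier)
include h₀ hT hfar hhubη hhubQ

variable (𝒯 d₀) in
/-- Two loop indices lie in a common open stretch (after shifting by periods). [folklore] -/
def SamePort (i j : ℕ) : Prop :=
  ∃ a b lo hi : ℕ, lo ≤ i + a * period h₀ ∧ i + a * period h₀ ≤ hi ∧ lo ≤ j + b * period h₀ ∧ j + b * period h₀ ≤ hi ∧
    ∀ l, lo ≤ l → l ≤ hi → 𝒯.IsOpenSide d₀ l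

/-- **Hub contacts of one port are revealed-connected.** [cite: SchrammSmirnov2011, §4, proof of Prop. 4.1 (one vertex of G per open bay)] -/
theorem gst_of_samePort {i j : ℕ} (hi : 𝒯.hubContact d₀ i) (hj : 𝒯.hubContact d₀ j) (hij : 𝒯.SamePort d₀ h₀ i j) :
    𝒯.Gst d₀ Q δ η i j := by
  obtain ⟨a, b, lo, hi', h1, h2, h3, h4, hopen⟩ := hij
  -- work with the shifted indices, then transport back by periodicity of the out-cells
  have hper : ∀ n q, 𝒯.outCell d₀ (n + q * period h₀) = 𝒯.outCell d₀ n := outCell_add_mul_period h₀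
  have hi' : 𝒯.hubContact d₀ (i + a * period h₀) := by rwa [TileData.hubContact, hper]
  have hj' : 𝒯.hubContact d₀ (j + b * period h₀) := by rwa [TileData.hubContact, hper]
  obtain ⟨v, hv⟩ := 𝒯.att_nonempty hi'
  obtain ⟨w, hw⟩ := 𝒯.att_nonempty hj'
  have hconn : 𝒯.HubConn v w := by
    rcases le_total (i + a * period h₀) (j + b * period h₀) with hle | hle
    · exact hubConn_of_open_stretch' h₀ hT hfar hle (fun l hl1 hl2 => hopen l (by omega) (by omega)) hi' hj' hv hw
    · exact (hubConn_of_open_stretch' h₀ hT hfar hle (fun l hl1 hl2 => hopen l (by omega) (by omega)) hj' hi' hw hv).symm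
  have hvW : v ∈ 𝒯.Wv := att_mem_Wv hT h₀ hi' hv
  have hvpt : meshPoint δ v ∈ openEdgeUnion δ (η \ ↑𝒯.acc) ∧ meshPoint δ v ∈ Q.carrier :=
    ⟨meshPoint_mem_openEdgeUnion_of_hub hhubη hv.1 hvW, meshPoint_mem_carrier_of_hub hhubQ hv.1 hvW⟩
  refine ⟨hi, hj, v, ?_, w, ?_, revPt_of_hubConn hhubη hhubQ hconn hvpt⟩
  · rw [TileData.hubContact] at hi; rwa [hper] at hv
  · rwa [hper] at hw

variable (𝒯 d₀) in
/-- **Port-level bits**: dockings at two hub contacts of DIFFERENT ports joined through `U`, up to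
moving each contact inside its port. [cite: SchrammSmirnov2011, §4, proof of Prop. 4.1 (edges of G*)] -/
def PortBit (η : BondConfig (Site 2)) (i j : ℕ) : Prop :=
  𝒯.hubContact d₀ i ∧ 𝒯.hubContact d₀ j ∧ ¬ 𝒯.SamePort d₀ h₀ i j ∧
    ∃ i' j', 𝒯.SamePort d₀ h₀ i i' ∧ 𝒯.SamePort d₀ h₀ j j' ∧ 𝒯.Bit d₀ η i' j'

omit hT hfar hhubη hhubQ in
/-- A hub contact is in the same port as itself. [folklore] -/
theorem samePort_refl {i : ℕ} (hi : 𝒯.hubContact d₀ i) : 𝒯.SamePort d₀ h₀ i i :=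
  ⟨0, 0, i, i, by omega, by omega, by omega, by omega, fun l h1 h2 => by
    rw [show l = i by omega]; exact Or.inl hi⟩

omit hT hfar hhubη hhubQ in
/-- `SamePort` is symmetric. [folklore] -/
theorem SamePort.symm {i j : ℕ} (h : 𝒯.SamePort d₀ h₀ i j) : 𝒯.SamePort d₀ h₀ j i := by
  obtain ⟨a, b, lo, hi, h1, h2, h3, h4, hopen⟩ := h
  exact ⟨b, a, lo, hi, h3, h4, h1, h2, hopen⟩

variable (hδ : 0 < δ) (hcons : ∀ e ∈ 𝒯.clE, e ∉ η)
  (hX : ∀ e ∈ (zdGraph 2).edgeSet, (∃ v ∈ e, v ∈ 𝒯.Wv) → (∃ u ∈ e, u ∉ 𝒯.Wv) → e ∈ 𝒯.hubE ∨ e ∈ 𝒯.clE)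
  (hside0 : Disjoint (Q.side 0) (openEdgeUnion δ (η ∩ ↑𝒯.acc))) (hside2 : Disjoint (Q.side 2) (openEdgeUnion δ (η ∩ ↑𝒯.acc)))
  (hacc : ∀ u v : Site 2, AccAdj η (↑𝒯.acc) u v → segment ℝ (meshPoint δ u) (meshPoint δ v) ⊆ Q.carrier)
include hδ hcons hX hside0 hside2 hacc

/-- **The crossing event of the cut quad as a function of the explored data and the port-level
bits.** [cite: SchrammSmirnov2011, §4, proof of Prop. 4.1 ("ω̃ ∈ ⊞_{Q₀} iff there is a path from ∂₀Q₀ to ∂₂Q₀ in G ∪ G*")] -/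
theorem mem_z2QuadConfig_iff_portChain :
    Q ∈ z2QuadConfig D δ η ↔ ∃ z₀ ∈ Q.side 0 ∩ openEdgeUnion δ η, ∃ z₂ ∈ Q.side 2,
      𝒯.RevPt Q δ η z₀ z₂ ∨ ∃ i j, 𝒯.StartAt d₀ Q δ η z₀ i ∧
        ReflTransGen (fun a b => 𝒯.Gst d₀ Q δ η a b ∨ 𝒯.PortBit d₀ h₀ η a b) i j ∧ 𝒯.EndAt d₀ Q δ η j z₂ := by
  rw [mem_z2QuadConfig_iff_sideChain h₀ hδ hcons hX hhubη hhubQ hside0 hside2 hacc]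
  -- the two chain relations generate the same connectivity between hub contacts
  have bitHub : ∀ {a b}, 𝒯.Bit d₀ η a b → 𝒯.hubContact d₀ a ∧ 𝒯.hubContact d₀ b := by
    rintro a b ⟨x, k, x', k', ⟨hσ, hβ, -, hcpt⟩, ⟨hσ', hβ', -, hcpt'⟩, -⟩
    exact ⟨(𝒯.hubContact_of_docking h₀ (mem_O_of_dock hσ hβ) hβ hcpt).2.1,
      (𝒯.hubContact_of_docking h₀ (mem_O_of_dock hσ' hβ') hβ' hcpt').2.1⟩
  have fwd : ∀ {a b}, (𝒯.Gst d₀ Q δ η a b ∨ 𝒯.Bit d₀ η a b) →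
      ReflTransGen (fun a b => 𝒯.Gst d₀ Q δ η a b ∨ 𝒯.PortBit d₀ h₀ η a b) a b := by
    rintro a b (h | h)
    · exact ReflTransGen.single (Or.inl h)
    · obtain ⟨ha, hb⟩ := bitHub h
      by_cases hsame : 𝒯.SamePort d₀ h₀ a b
      · exact ReflTransGen.single (Or.inl (gst_of_samePort h₀ hT hfar hhubη hhubQ ha hb hsame))
      · exact ReflTransGen.single (Or.inr ⟨ha, hb, hsame, a, b, samePort_refl h₀ ha, samePort_refl h₀ hb, h⟩ :
          𝒯.Gst d₀ Q δ η a b ∨ 𝒯.PortBit d₀ h₀ η a b)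
  have bwd : ∀ {a b}, (𝒯.Gst d₀ Q δ η a b ∨ 𝒯.PortBit d₀ h₀ η a b) →
      ReflTransGen (fun a b => 𝒯.Gst d₀ Q δ η a b ∨ 𝒯.Bit d₀ η a b) a b := by
    rintro a b (h | ⟨ha, hb, -, a', b', haa', hbb', hbit⟩)
    · exact ReflTransGen.single (Or.inl h)
    · obtain ⟨ha', hb'⟩ := bitHub hbit
      have s1 : ReflTransGen (fun a b => 𝒯.Gst d₀ Q δ η a b ∨ 𝒯.Bit d₀ η a b) a a' :=
        ReflTransGen.single (Or.inl (gst_of_samePort h₀ hT hfar hhubη hhubQ ha ha' haa'))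
      have s2 : ReflTransGen (fun a b => 𝒯.Gst d₀ Q δ η a b ∨ 𝒯.Bit d₀ η a b) a b' := s1.tail (Or.inr hbit)
      exact s2.tail (Or.inl (gst_of_samePort h₀ hT hfar hhubη hhubQ hb' hb hbb'.symm))
  have lift : ∀ {r r' : ℕ → ℕ → Prop}, (∀ {a b}, r a b → ReflTransGen r' a b) → ∀ {a b}, ReflTransGen r a b → ReflTransGen r' a b := by
    intro r r' h a b hab
    induction hab with
    | refl => exact ReflTransGen.refl
    | tail _ hs ih => exact ih.trans (h hs)
  constructor
  · rintro ⟨z₀, hz₀, z₂, hz₂, h⟩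
    refine ⟨z₀, hz₀, z₂, hz₂, h.imp id ?_⟩
    rintro ⟨i, j, hs, hc, he⟩
    exact ⟨i, j, hs, lift fwd hc, he⟩
  · rintro ⟨z₀, hz₀, z₂, hz₂, h⟩
    refine ⟨z₀, hz₀, z₂, hz₂, h.imp id ?_⟩
    rintro ⟨i, j, hs, hc, he⟩
    exact ⟨i, j, hs, lift bwd hc, he⟩

end Stretch

end TileData

end CellComplex

end Literature.Probability.Percolation

end
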